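import Mathlib
import HarnessLib
import Literature.NumberTheory.LFunctions.ZetaScrew
import Summits.RiemannHypothesis.RiemannHypothesis.Theorems.IntegerScrewHingeBrackets
import Summits.RiemannHypothesis.RiemannHypothesis.Theorems.IntegerScrewArithmeticBrackets

/-!
# Route `IntegerScrew` — carrier against carrier along a divisor chain: for prime powers `q ∣ q′ = q·m`,
# `M·⟨I_{⌈M/q⌉}, I_{⌈M/q′⌉}⟩ → −q·Λ(m)/√m` (PIVOT-LAW §15.18 (i), the last DERIVED entry of the closed-form model; RH-FREE)

The hinge carriers of two integers `q` and `q′ = q·m` are themselves in the carrier relation: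
`⌈⌈M/q⌉/m⌉ = ⌈M/(q m)⌉` (`ceilDiv_ceilDiv`), so the carrier `⌈M/q′⌉` of `M` at ratio `q′` is the carrier of the
corner `a = ⌈M/q⌉` at ratio `m`, and `IntegerScrewHingeBrackets.tendsto_hingeCov_ceil` at that corner gives
`a·⟨I_a, I_{⌈a/m⌉}⟩ → −Λ(m)/√m`; with `M/a → q`:

* `ceilDiv_ceilDiv` — `((M + q − 1)/q + m − 1)/m = (M + q m − 1)/(q m)` for `q, m ≥ 1`;
* `tendsto_ceilDiv_atTop` — `⌈M/q⌉ → ∞`;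
* **`tendsto_carrierChain`** — for `q ≥ 1`, `m ≥ 2`:
  `M·[Ψ(log(a/(b−1))) + Ψ(log((a−1)/b)) − Ψ(log(a/b)) − Ψ(log((a−1)/(b−1)))] → −q·Λ(m)/√m`,
  `a = ⌈M/q⌉`, `b = ⌈M/(qm)⌉` — i.e. `M·Cov(I_{⌈M/q⌉}, I_{⌈M/q′⌉}) → −q·Λ(q′/q)/√(q′/q)` when `q ∣ q′`
  (and `→ 0` when `q ∤ q′`, `IntegerScrewFarDecorrelation`).

With this every entry of the model Gram system of PIVOT-LAW §15.18 is a THEOREM-level limit.  Elementary; nothing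
here bears on the truth of RH. [Suzuki2023, (1.1)]
-/

noncomputable section

-- D-0017: `Summit.<S>.<S>.…` is the designed namespace of a single-problem summit.
set_option linter.dupNamespace false

namespace Summit.RiemannHypothesis.RiemannHypothesis.Theorems.IntegerScrew

open Literature.NumberTheory.LFunctions Filter Finset
open scoped Topology

/-- Nested ceiling division: `⌈⌈M/q⌉/m⌉ = ⌈M/(q m)⌉`, i.e. `((M + q − 1)/q + m − 1)/m = (M + q m − 1)/(q m)`
for `q, m ≥ 1`. [folklore] -/
theorem ceilDiv_ceilDiv {q m : ℕ} (hq : 1 ≤ q) (hm : 1 ≤ m) (M : ℕ) :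
    ((M + q - 1) / q + m - 1) / m = (M + q * m - 1) / (q * m) := by
  -- both sides are the least `c` with `M ≤ q m c`
  have keyL : ∀ c : ℕ, ((M + q - 1) / q + m - 1) / m ≤ c ↔ M ≤ q * (m * c) := by
    intro c
    rw [Nat.div_le_iff_le_mul_add_pred (by omega : 0 < m)]
    have step : (M + q - 1) / q ≤ m * c ↔ M ≤ q * (m * c) := by
      rw [Nat.div_le_iff_le_mul_add_pred (by omega : 0 < q)]
      generalize q * (m * c) = R
      omega
    generalize hP : m * c = P at step ⊢
    constructor
    · intro h; exact step.1 (by omega)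
    · intro h; have := step.2 h; omega
  have keyR : ∀ c : ℕ, (M + q * m - 1) / (q * m) ≤ c ↔ M ≤ q * (m * c) := by
    intro c
    have hqm : 0 < q * m := Nat.mul_pos (by omega) (by omega)
    rw [Nat.div_le_iff_le_mul_add_pred hqm, show q * m * c = q * (m * c) by ring]
    generalize q * (m * c) = R
    generalize hN : q * m = N at hqm ⊢
    omega
  exact le_antisymm ((keyL _).2 ((keyR _).1 le_rfl)) ((keyR _).2 ((keyL _).1 le_rfl))

/-- `⌈M/q⌉ = (M + q − 1)/q → ∞` (`q ≥ 1`). [folklore] -/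
theorem tendsto_ceilDiv_atTop {q : ℕ} (hq : 1 ≤ q) :
    Tendsto (fun M : ℕ => (M + q - 1) / q) atTop atTop := by
  refine tendsto_atTop_atTop.2 fun c => ⟨q * c, fun M hM => ?_⟩
  refine (Nat.le_div_iff_mul_le (by omega)).2 ?_
  rw [mul_comm]
  generalize hP : q * c = P at hM ⊢
  omega

/-- **CARRIER AGAINST CARRIER ALONG A DIVISOR CHAIN.**  For `q ≥ 1`, `m ≥ 2`, with `a = ⌈M/q⌉ = (M+q−1)/q` and
`b = ⌈M/(qm)⌉ = (M+qm−1)/(qm)` (`= ⌈a/m⌉`):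
`M·[Ψ(log(a/(b−1))) + Ψ(log((a−1)/b)) − Ψ(log(a/b)) − Ψ(log((a−1)/(b−1)))] → −q·Λ(m)/√m` —
the hinge carriers of `q` and `q′ = qm` resonate with amplitude `−q·Λ(q′/q)/√(q′/q)` at order `1/M`. [folklore] -/
theorem tendsto_carrierChain {q m : ℕ} (hq : 1 ≤ q) (hm : 2 ≤ m) :
    Tendsto (fun M : ℕ => (M : ℝ) *
        (zetaScrew (Real.log ((((M + q - 1) / q : ℕ) : ℝ) / ((((M + q * m - 1) / (q * m) : ℕ) : ℝ) - 1)))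
          + zetaScrew (Real.log (((((M + q - 1) / q : ℕ) : ℝ) - 1) / (((M + q * m - 1) / (q * m) : ℕ) : ℝ)))
          - zetaScrew (Real.log ((((M + q - 1) / q : ℕ) : ℝ) / (((M + q * m - 1) / (q * m) : ℕ) : ℝ)))
          - zetaScrew (Real.log (((((M + q - 1) / q : ℕ) : ℝ) - 1) / ((((M + q * m - 1) / (q * m) : ℕ) : ℝ) - 1)))))
      atTop (𝓝 (-(q : ℝ) * (ArithmeticFunction.vonMangoldt m / Real.sqrt m))) := by
  have hq0 : (0 : ℝ) < q := by exact_mod_cast (by omega : 0 < q)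
  -- the hinge resonance at the corner a = ⌈M/q⌉, composed with M ↦ ⌈M/q⌉ → ∞
  have h1 := (tendsto_hingeCov_ceil hm).comp (tendsto_ceilDiv_atTop hq)
  -- the prefactor M/⌈M/q⌉ → q
  have h2 : Tendsto (fun M : ℕ => (M : ℝ) / ((((M + q - 1) / q : ℕ)) : ℝ)) atTop (𝓝 (q : ℝ)) := by
    have h := (tendsto_ceilDiv_div hq).inv₀ (by positivity : (1 / (q : ℝ)) ≠ 0)
    rw [one_div, inv_inv] at h
    refine h.congr' ?_
    filter_upwards [eventually_ge_atTop 1] with M hM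
    rw [inv_div]
  have h3 := h2.mul h1
  rw [show (q : ℝ) * -(ArithmeticFunction.vonMangoldt m / Real.sqrt m)
      = -(q : ℝ) * (ArithmeticFunction.vonMangoldt m / Real.sqrt m) by ring] at h3
  refine h3.congr' ?_
  filter_upwards [eventually_ge_atTop (q + 1)] with M hM
  have hc : ((M + q - 1) / q + m - 1) / m = (M + q * m - 1) / (q * m) := ceilDiv_ceilDiv hq (by omega) M
  have ha1 : 1 ≤ (M + q - 1) / q := (Nat.le_div_iff_mul_le (by omega)).2 (by omega)
  have ha0 : (0 : ℝ) < ((((M + q - 1) / q : ℕ)) : ℝ) := by exact_mod_cast ha1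
  simp only [Function.comp_apply, hc]
  field_simp

end Summit.RiemannHypothesis.RiemannHypothesis.Theorems.IntegerScrew

end
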